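import Mathlib
import Summits.Parity.GeneralizedHardyLittlewood.Theorems.PrimeGapInitialSegmentPart3
import HarnessLib

/-!
# Prime-gap limit points: the cap on the initial segment `[0, 7·inf U]` and the density of `𝓛` on `[0, 7c]` (cell parity-ideate, p4 ROUNDS 13–16, line L9) — part 4/4 (`cap_first_gap_of_additiveLemma` … `primeGap_density_initial_segment`)

Source: `HOME/parity-ideate-p4/round16/Sketch20.lean` (sha16 b835d559e74496fc, 4 997 lines, farm rc 0 / 0 warnings / 0 sorry /
axioms std-3; namespace `ParityIdeateP4R15`), §0–§3, cut by parity-ideate-p4 g19 (`ports/w7/build_w7.py`, pattern of lit g32's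
`ports/toruscap/build_toruscap.py`) to the dependency cone of the headline declarations `cap_first_period` (T ≤ 5m),
`cap_second_window` ([6m,7m]), `additiveLemma_holds` + `cap_first_gap` ([5m,6m]), `cap_le_seven`, `asymptoticCap4_le_seven`,
`fourPointFree_iff_triangleFree`, `fourPointFree_iff_delta4Free`, `primeGap_le_seven`, `primeGap_density_initial_segment`,
in a chain of 4 files of ≤ 400 lines (Theorems-side lint).  Statements byte-identical to the source EXCEPT (reuse, no
re-declaration): the vocabulary `BrauerFree`, `FourPointFree` and the lemma `brauerFree_of_fourPointFree` are the TREE's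
(`…Theorems.PrimeGapTorusCapPart1/Part6`, definitionally identical to the source's §0 `BrauerFree`/`FourPointFree`/
`FourPointFree.brauerFree`), the three dot-notation lemmas are renamed to flat names (`FourPointFree.delta4Free`/`.no_threeAP`/`.reflection` ↦ `fourPointFree_delta4Free`/`fourPointFree_no_threeAP`/`fourPointFree_reflection`) with their
five call sites rewritten, namespace `ParityIdeateP4R15` ↦ `Summit.Parity.GeneralizedHardyLittlewood.Theorems.PrimeGapInitialSegment`.
Non-Mathlib inputs: `Literature.NumberTheory.Sieve.PrimeGapLimitPoints` (`primeGapLimitSet`, `isClosed_primeGapLimitSet`, the NAMED fact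
`Merikoski2020_theorem1` = Merikoski 2020 Theorem 1, used HYPOTHESIS-STYLE, never asserted).  No `sorry`, no new axioms, no `instance`, no notation.
Cell-original mathematics (FRONTIER formalisation; record/instrument — nothing here bears on the parity problem): for a measurable
FOUR-POINT-FREE `U ⊆ (m,∞)` (no `x,y,z ∈ U` with `x+y, y+z, x+y+z ∈ U`) whose infimum `m ≥ 0` is approached from inside `U`,
`vol(U ∩ [0,T]) ≤ (T+m)/2` for every `T ≤ 7m` (one difference on `[0,5m]`; a reflection injection on `[6m,7m]`; one additive
lemma on the gap `[5m,6m]`); pay-off: given Merikoski's four-point theorem, with `c := sInf((0,∞) ∖ 𝓛)` the prime-gap limit-point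
set `𝓛` has `vol(𝓛 ∩ [0,T]) ≥ (T − c)/2` for all `0 ≤ T ≤ 7c` (print: `T/3`, [Merikoski2020GapLimitPoints, Cor. 2]).  The window
`(7m, 8m]` is OPEN (cell record: reduced to `HeavyBound`; pure cases proved; not in this port). HEADLINE DECLS IN THIS PART: `cap_le_seven`, `cap_first_gap`, `asymptoticCap4_le_seven`, `primeGap_lower_of_compl_cap`, `primeGap_le_seven`, `primeGap_density_initial_segment`.
-/

open Set MeasureTheory Filter
namespace Summit.Parity.GeneralizedHardyLittlewood.Theorems.PrimeGapInitialSegment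
open Summit.Parity.GeneralizedHardyLittlewood.Theorems.PrimeGapTorusCap (BrauerFree FourPointFree brauerFree_of_fourPointFree)
open Literature.NumberTheory.Sieve
section FirstGap
variable {U : Set ℝ}

/-- **THE FIRST GAP** modulo the additive lemma: for `T ∈ [5m, 6m]`, `vol(U ∩ [0,T]) ≤ (T + m)/2`. -/
theorem cap_first_gap_of_additiveLemma (hAL : AdditiveLemma) (hUm : MeasurableSet U)
    (h4 : FourPointFree U) {m : ℝ} (hm : 0 ≤ m) (hUgt : U ⊆ Ioi m) (hinf : ∀ ε > 0, ∃ u ∈ U, u < m + ε)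
    {T : ℝ} (h5 : 5 * m ≤ T) (h6 : T ≤ 6 * m) :
    volume (U ∩ Icc 0 T) ≤ ENNReal.ofReal ((T + m) / 2) := by
  have hc : 0 ≤ (T + m) / 2 := by linarith
  have key : ∀ δ : ℝ, 0 < δ → volume (U ∩ Icc 0 T) ≤ ENNReal.ofReal ((T + m) / 2 + δ) := by
    intro δ hδ
    obtain ⟨u, huU, hu⟩ := hinf (δ / 5) (by linarith)
    have hmu : m < u := hUgt huU
    have hu0 : 0 < u := lt_of_le_of_lt hm hmu
    set τ : ℝ := T - 5 * m with hτ
    have hτ0 : 0 ≤ τ := by linarith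
    have hτu : τ ≤ u := by linarith
    have hcov : U ∩ Icc 0 T ⊆ Ioo m u ∪ U ∩ Ico u (5 * u + τ) := by
      rintro x ⟨hxU, hx0, hxT⟩
      have hxm : m < x := hUgt hxU
      rcases lt_or_ge x u with h | h
      · exact Or.inl ⟨hxm, h⟩
      · exact Or.inr ⟨hxU, h, by linarith⟩
    calc volume (U ∩ Icc 0 T)
        ≤ volume (Ioo m u ∪ U ∩ Ico u (5 * u + τ)) := measure_mono hcov
      _ ≤ volume (Ioo m u) + volume (U ∩ Ico u (5 * u + τ)) := measure_union_le _ _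
      _ ≤ ENNReal.ofReal (u - m) + ENNReal.ofReal (3 * u + τ / 2) := by
          rw [Real.volume_Ioo]
          gcongr
          exact firstGap_core hAL hUm h4 hu0 huU hτ0 hτu
      _ ≤ ENNReal.ofReal ((T + m) / 2 + δ) := by
          rw [← ENNReal.ofReal_add (by linarith) (by linarith)]
          exact ENNReal.ofReal_le_ofReal (by rw [hτ]; linarith)
  refine ENNReal.le_of_forall_pos_le_add fun ε hε _ => ?_
  calc volume (U ∩ Icc 0 T) ≤ ENNReal.ofReal ((T + m) / 2 + ε) := key ε (by exact_mod_cast hε)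
    _ = ENNReal.ofReal ((T + m) / 2) + ε := by
        rw [ENNReal.ofReal_add hc ε.coe_nonneg, ENNReal.ofReal_coe_nnreal]

/-- THE CAP ON ALL OF `[0, 7m]` modulo the additive lemma (first period + first gap + second window). -/
theorem cap_le_seven_of_additiveLemma (hAL : AdditiveLemma) (hUm : MeasurableSet U)
    (h4 : FourPointFree U) {m : ℝ} (hm : 0 ≤ m) (hUgt : U ⊆ Ioi m) (hinf : ∀ ε > 0, ∃ u ∈ U, u < m + ε)
    {T : ℝ} (hT : T ≤ 7 * m) :
    volume (U ∩ Icc 0 T) ≤ ENNReal.ofReal ((T + m) / 2) := by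
  rcases le_or_gt T (5 * m) with h5 | h5
  · exact cap_first_period hUm (brauerFree_of_fourPointFree h4) hm hUgt hinf h5
  rcases le_or_gt T (6 * m) with h6 | h6
  · exact cap_first_gap_of_additiveLemma hAL hUm h4 hm hUgt hinf h5.le h6
  · exact cap_second_window hUm h4 hm hUgt hinf h6.le hT

/-- **THE CAP ON ALL OF `[0, 7m]`** (unconditional): for a measurable four-point-free `U ⊆ (m, ∞)`,
`m ≥ 0` approached from inside `U`, `vol(U ∩ [0,T]) ≤ (T + m)/2` for every `T ≤ 7m`. -/
theorem cap_le_seven (hUm : MeasurableSet U) (h4 : FourPointFree U) {m : ℝ} (hm : 0 ≤ m)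
    (hUgt : U ⊆ Ioi m) (hinf : ∀ ε > 0, ∃ u ∈ U, u < m + ε) {T : ℝ} (hT : T ≤ 7 * m) :
    volume (U ∩ Icc 0 T) ≤ ENNReal.ofReal ((T + m) / 2) :=
  cap_le_seven_of_additiveLemma additiveLemma_holds hUm h4 hm hUgt hinf hT

/-- The first gap alone, unconditional. -/
theorem cap_first_gap (hUm : MeasurableSet U) (h4 : FourPointFree U) {m : ℝ} (hm : 0 ≤ m)
    (hUgt : U ⊆ Ioi m) (hinf : ∀ ε > 0, ∃ u ∈ U, u < m + ε) {T : ℝ} (h5 : 5 * m ≤ T)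
    (h6 : T ≤ 6 * m) : volume (U ∩ Icc 0 T) ≤ ENNReal.ofReal ((T + m) / 2) :=
  cap_first_gap_of_additiveLemma additiveLemma_holds hUm h4 hm hUgt hinf h5 h6

/-- `(A∞')` in its own currency (`U` open, `u ∈ U`) on the initial segment `T ≤ 7u`. -/
theorem asymptoticCap4_le_seven {U : Set ℝ} (hU : IsOpen U) (hU0 : U ⊆ Ioi 0)
    (h4 : FourPointFree U) {u : ℝ} (hu : u ∈ U) {T : ℝ} (hT : T ≤ 7 * sInf U) :
    volume (U ∩ Icc 0 T) ≤ ENNReal.ofReal ((T + u) / 2) := by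
  have hne : U.Nonempty := ⟨u, hu⟩
  have hbdd : BddBelow U := ⟨0, fun x hx => (hU0 hx).le⟩
  have hm0 : 0 ≤ sInf U := le_csInf hne fun x hx => (hU0 hx).le
  have hmu : sInf U ≤ u := csInf_le hbdd hu
  -- `inf U ∉ U` since `U` is open and four-point-free (else `u/2`-type descent); we only need `U ⊆ Ioi (sInf U)`
  -- in the weak form: every `x ∈ U` has `sInf U ≤ x`, and `sInf U ∈ U` is impossible for an OPEN
  -- four-point-free set (it would contain an interval `[s, s+δ)` at its infimum `s > 0`, and then the cap
  -- argument is applied with `m` slightly below) — to stay elementary we treat the two cases.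
  by_cases hmem : sInf U ∈ U
  · -- `U` open: some `x ∈ U` with `x < sInf U`? impossible; so `sInf U` is the least element and an
    -- interior point: pick `m' < sInf U` close, apply nothing — instead use monotonicity in `m`:
    -- the bound `(T + u)/2 ≥ (T + sInf U)/2` and the cap at level `m := sInf U` needs `U ⊆ Ioi m`, false.
    -- Work-around: shrink to `U' := U ∩ Ioi (sInf U)`, which has the same measure on every window
    -- (differs from `U` by one point), is four-point-free, and has infimum `sInf U` approached.
    set U' : Set ℝ := U ∩ Ioi (sInf U) with hU'
    have hU'm : MeasurableSet U' := hU.measurableSet.inter measurableSet_Ioi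
    have h4' : FourPointFree U' := fun x y z hx hy hz hxy hyz hxyz =>
      h4 x y z hx.1 hy.1 hz.1 hxy.1 hyz.1 hxyz.1
    have hUgt' : U' ⊆ Ioi (sInf U) := fun x hx => hx.2
    have hinf' : ∀ ε > 0, ∃ x ∈ U', x < sInf U + ε := by
      intro ε hε
      obtain ⟨δ, hδ, hball⟩ := Metric.isOpen_iff.1 hU (sInf U) hmem
      refine ⟨sInf U + min (δ / 2) (ε / 2), ⟨hball ?_, ?_⟩, ?_⟩
      · rw [Metric.mem_ball, Real.dist_eq]
        have h1 : 0 < min (δ / 2) (ε / 2) := lt_min (by linarith) (by linarith)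
        have h2 : min (δ / 2) (ε / 2) ≤ δ / 2 := min_le_left _ _
        rw [abs_of_nonneg (by linarith)]; linarith
      · show sInf U < sInf U + min (δ / 2) (ε / 2)
        have h1 : 0 < min (δ / 2) (ε / 2) := lt_min (by linarith) (by linarith)
        linarith
      · have h2 : min (δ / 2) (ε / 2) ≤ ε / 2 := min_le_right _ _
        linarith
    have hwin : volume (U ∩ Icc 0 T) ≤ volume (U' ∩ Icc 0 T) + volume ({sInf U} : Set ℝ) := by
      calc volume (U ∩ Icc 0 T) ≤ volume (U' ∩ Icc 0 T ∪ {sInf U}) := measure_mono fun x hx => by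
              rcases eq_or_ne x (sInf U) with h | h
              · exact Or.inr h
              · exact Or.inl ⟨⟨hx.1, lt_of_le_of_ne (csInf_le hbdd hx.1) (Ne.symm h)⟩, hx.2⟩
        _ ≤ volume (U' ∩ Icc 0 T) + volume ({sInf U} : Set ℝ) := measure_union_le _ _
    rw [Real.volume_singleton, add_zero] at hwin
    calc volume (U ∩ Icc 0 T) ≤ volume (U' ∩ Icc 0 T) := hwin
      _ ≤ ENNReal.ofReal ((T + sInf U) / 2) := cap_le_seven hU'm h4' hm0 hUgt' hinf' hT
      _ ≤ ENNReal.ofReal ((T + u) / 2) := ENNReal.ofReal_le_ofReal (by linarith)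
  · have hUgt : U ⊆ Ioi (sInf U) := fun x hx =>
      lt_of_le_of_ne (csInf_le hbdd hx) (fun h => hmem (h ▸ hx))
    have hinf : ∀ ε > 0, ∃ x ∈ U, x < sInf U + ε := fun ε hε => by
      obtain ⟨x, hx, hlt⟩ := exists_lt_of_csInf_lt hne (show sInf U < sInf U + ε by linarith)
      exact ⟨x, hx, hlt⟩
    calc volume (U ∩ Icc 0 T) ≤ ENNReal.ofReal ((T + sInf U) / 2) :=
          cap_le_seven hU.measurableSet h4 hm0 hUgt hinf hT
      _ ≤ ENNReal.ofReal ((T + u) / 2) := ENNReal.ofReal_le_ofReal (by linarith)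

end FirstGap
/-! ## §3 Pay-off for `𝓛`: the window `[6c, 7c]` and the whole known region `[0,5c] ∪ [6c,7c]` -/

section PayOff
variable {U : Set ℝ}
/-- From a cap for the complement to a lower bound for `𝓛` on the same window. -/
theorem primeGap_lower_of_compl_cap {c T : ℝ} (hc : 0 ≤ c) (hT0 : 0 ≤ T)
    (hcap : volume ((Ioi 0 \ primeGapLimitSet) ∩ Icc 0 T) ≤ ENNReal.ofReal ((T + c) / 2)) :
    ENNReal.ofReal ((T - c) / 2) ≤ volume (primeGapLimitSet ∩ Icc 0 T) := by
  by_cases hcT : c ≤ T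
  swap
  · rw [ENNReal.ofReal_of_nonpos (by linarith)]; exact zero_le
  set B : Set ℝ := primeGapLimitSet with hBdef
  set U : Set ℝ := Ioi 0 \ primeGapLimitSet with hUdef
  have hcover : Icc 0 T ⊆ (B ∩ Icc 0 T) ∪ (U ∩ Icc 0 T) ∪ {0} := by
    intro t ht
    by_cases htB : t ∈ B
    · exact Or.inl (Or.inl ⟨htB, ht⟩)
    rcases ht.1.eq_or_lt with h0 | hpos
    · right; simp [h0.symm]
    · exact Or.inl (Or.inr ⟨⟨hpos, htB⟩, ht⟩)
  have hTc : 0 ≤ (T + c) / 2 := by linarith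
  have key : ENNReal.ofReal T ≤ volume (B ∩ Icc 0 T) + ENNReal.ofReal ((T + c) / 2) := by
    calc ENNReal.ofReal T = volume (Icc (0:ℝ) T) := by simp [Real.volume_Icc]
      _ ≤ volume ((B ∩ Icc 0 T) ∪ (U ∩ Icc 0 T) ∪ {0}) := measure_mono hcover
      _ ≤ volume ((B ∩ Icc 0 T) ∪ (U ∩ Icc 0 T)) + volume ({0} : Set ℝ) := measure_union_le _ _
      _ = volume ((B ∩ Icc 0 T) ∪ (U ∩ Icc 0 T)) := by simp
      _ ≤ volume (B ∩ Icc 0 T) + volume (U ∩ Icc 0 T) := measure_union_le _ _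
      _ ≤ volume (B ∩ Icc 0 T) + ENNReal.ofReal ((T + c) / 2) := by gcongr
  have hsum : ENNReal.ofReal T = ENNReal.ofReal ((T - c) / 2) + ENNReal.ofReal ((T + c) / 2) := by
    rw [← ENNReal.ofReal_add (by linarith) hTc]; ring_nf
  rw [hsum] at key
  exact (ENNReal.add_le_add_iff_right ENNReal.ofReal_ne_top).1 key

/-- **THE PAY-OFF ON ALL OF `[0, 7c]`**: Merikoski's Theorem 1 gives `vol(𝓛 ∩ [0,T]) ≥ (T − c)/2` for
every `0 ≤ T ≤ 7c`, `c` = the infimum of the positive non-limit points, approached by them (print: `T/3`,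
[Mer20, Cor. 2]; at `T = 7c` this is `3c` against `2⅓c`). -/
theorem primeGap_le_seven (h : Merikoski2020_theorem1) {c : ℝ} (hc : 0 ≤ c)
    (hcL : ∀ x : ℝ, 0 < x → x ∉ primeGapLimitSet → c < x)
    (hinf : ∀ ε > 0, ∃ u : ℝ, 0 < u ∧ u ∉ primeGapLimitSet ∧ u < c + ε) {T : ℝ} (hT0 : 0 ≤ T)
    (hT : T ≤ 7 * c) :
    ENNReal.ofReal ((T - c) / 2) ≤ volume (primeGapLimitSet ∩ Icc 0 T) := by
  have hU : IsOpen (Ioi (0:ℝ) \ primeGapLimitSet) := isOpen_primeGap_compl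
  have hUgt : Ioi 0 \ primeGapLimitSet ⊆ Ioi c := fun x hx => hcL x hx.1 hx.2
  have hinfU : ∀ ε > 0, ∃ u ∈ Ioi 0 \ primeGapLimitSet, u < c + ε := fun ε hε => by
    obtain ⟨u, hu0, huL, hu⟩ := hinf ε hε
    exact ⟨u, ⟨hu0, huL⟩, hu⟩
  exact primeGap_lower_of_compl_cap hc hT0
    (cap_le_seven hU.measurableSet (fourPointFree_primeGap_compl h) hc hUgt hinfU hT)

/-- The same with `c := sInf ((0,∞) ∖ 𝓛)` SPELLED OUT and no side hypotheses: Merikoski's Theorem 1 implies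
`vol(𝓛 ∩ [0,T]) ≥ (T − c)/2` for every `0 ≤ T ≤ 7c`.  (If every positive real is a limit point the
hypothesis `T ≤ 7·sInf ∅ = 0` makes the statement empty — and moot.) -/
theorem primeGap_density_initial_segment (h : Merikoski2020_theorem1) {T : ℝ} (hT0 : 0 ≤ T)
    (hT : T ≤ 7 * sInf (Ioi (0:ℝ) \ primeGapLimitSet)) :
    ENNReal.ofReal ((T - sInf (Ioi (0:ℝ) \ primeGapLimitSet)) / 2) ≤
      volume (primeGapLimitSet ∩ Icc 0 T) := by
  set V : Set ℝ := Ioi (0:ℝ) \ primeGapLimitSet with hV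
  rcases V.eq_empty_or_nonempty with hV0 | hVne
  · -- no positive non-limit point: `sInf ∅ = 0`, so `T = 0`
    have hc0 : sInf V = 0 := by rw [hV0, Real.sInf_empty]
    rw [hc0] at hT ⊢
    have hT' : T = 0 := by linarith
    subst hT'
    simp
  have hbdd : BddBelow V := ⟨0, fun x hx => le_of_lt hx.1⟩
  have hc : 0 ≤ sInf V := le_csInf hVne fun x hx => le_of_lt hx.1
  have hVopen : IsOpen V := isOpen_primeGap_compl
  -- the infimum of an open set of positive reals is not attained
  have hcnot : sInf V ∉ V := fun hmem => by
    obtain ⟨δ, hδ, hball⟩ := Metric.isOpen_iff.1 hVopen (sInf V) hmem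
    have hlt : sInf V - δ / 2 ∈ V := hball (by
      rw [Metric.mem_ball, Real.dist_eq, abs_of_nonpos (by linarith)]; linarith)
    have := csInf_le hbdd hlt
    linarith
  have hcL : ∀ x : ℝ, 0 < x → x ∉ primeGapLimitSet → sInf V < x := fun x hx hxL =>
    lt_of_le_of_ne (csInf_le hbdd ⟨hx, hxL⟩) (fun e => hcnot (e ▸ ⟨hx, hxL⟩))
  have hinf : ∀ ε > 0, ∃ u : ℝ, 0 < u ∧ u ∉ primeGapLimitSet ∧ u < sInf V + ε := fun ε hε => by
    obtain ⟨x, hx, hlt⟩ := exists_lt_of_csInf_lt hVne (show sInf V < sInf V + ε by linarith)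
    exact ⟨x, hx.1, hx.2, hlt⟩
  exact primeGap_le_seven h hc hcL hinf hT0 hT

end PayOff
end Summit.Parity.GeneralizedHardyLittlewood.Theorems.PrimeGapInitialSegment
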